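import Literature.MathematicalPhysics.QuantumFieldTheory.Federbush1986.AxialTreeLocality
import Literature.MathematicalPhysics.QuantumFieldTheory.Federbush1986.AbelianEstimatesLe
import Literature.MathematicalPhysics.QuantumFieldTheory.Federbush1986.LatticeActionFiniteAction
import Mathlib.Analysis.Calculus.BumpFunction.InnerProduct

/-!
# `Federbush1986.PlaquetteConsistencyLocal` — [Federbush1986PhaseCellI] (1.13)–(1.14) p. 324, (2.12)–(2.13) p. 326, §4 p. 329:
# LOCALITY of the Bałaban bond assignments («A(e) depends only on A_μ(x) for d(x, e) < cℓ(e)») removes the global hypotheses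
# (2.3)–(2.4) from rows F1.Eq2.12, F1.Eq1.13 and F1.Sect§4 for the concrete averaging `axialTreeAveraging`: the plaquette
# identity `A_∂p = (1.13)` and the lattice-action convergence hold for EVERY `C¹` potential (finite action for the real series)

statement-level skeleton of published theorems with citation tags; proofs where landed; nothing here is a claim about the Yang–Mills mass gap

CITATION HEADER.  P. Federbush, *A phase cell approach to Yang–Mills theory. I. Modes, lattice-continuum duality*, Commun.
Math. Phys. **107** (1986) 319–329 [Federbush1986PhaseCellI]: (2.13) p. 326 *«A(e) depends only on A_μ(x) for d(x, e) <
cℓ(e)»*; (2.12) p. 326 *«the limit of r-approximates exists … A(e) = lim A(e, r₀)»*; p. 325 *«this assignment yields the correct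
plaquette variables»* ((1.13)–(1.14) p. 324); §4 p. 329 *«it is straightforward to show the lattice actions S^r_0 approach the
continuum action as r → ∞»*; §3 (3.1) p. 326–327 (modes are `C¹`).  Unit `lit-balaban-r17` gen 4 (fold owner of the Federbush
block); SKELETON rows **F1.Eq2.12** (`axialTreeAveraging_eq212`, p244549), **F1.Eq1.13** (`axialTreeAveraging_plaquette
AssignmentsEq114`, p245853), **F1.Sect§4** (`LatticeActionLimit` p250575, `LatticeActionFiniteAction` p253133) — all three so
far under the global bounds (2.3)–(2.4) `|A_μ| ≤ B₁`, `|∂A_μ| ≤ B₂`.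

THE MATHEMATICS.  (i) LOCALITY (`AxialTreeLocality`, p245848): the r-approximate `A(e, r₀)` (`r₀ ≥ s`) of the level-`s` edge
`e` reads `A` only at points within `11ℓ_s` of the base vertex of `e` (`iterate_avStep_congr_local` + `dist_sample_lt`); hence
two potentials that agree on that ball have the same r-approximates for all `r₀ ≥ s`, the same limit (2.12) (a `limUnder` of
eventually equal sequences), and — for a plaquette `p`, whose four edges are based within `ℓ_s` of `p.src` — the same `A_∂p`;
the continuum functional (1.13) reads `A` only within `4ℓ_s` of `p.src`.  (ii) CUT-OFF: for a `C¹` potential `A` and a ball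
`B(c, R)` the field `χ·A`, `χ` a smooth bump `≡ 1` on `B̄(c, R)` supported in `B(c, 2R)` (`ContDiffBump`), is `C¹`, agrees
with `A` on `B(c, R)`, and obeys (2.3)–(2.4) globally (continuous with compact support, likewise its derivative).  (i)+(ii):
(2.12), the plaquette identity `A_∂p = plaqFunctional` and therefore everything in `LatticeActionFiniteAction` hold for every
`C¹` potential: **`S^s_0 ≤ contAction A` at every level and `S^s_0 → contAction A` (in `ℝ≥0∞`) for every `C¹` `A`, in
particular for every MODE** (`IsMode` ⇒ `C¹`); with finite action the real series converge and row F1.Sect§4's conclusion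
holds with the single binder `contAction A ≠ ⊤`.

READING NOTE (fold owner r17).  After this file the only hypothesis separating the typed row `LatticeActionsConvergeSummable c₀`
(antecedent `IsMode c₀ r A` alone) from a theorem is FINITENESS OF THE ACTION of the mode; `IsConstrainedMinimizer` does not
assert it (it holds as soon as one `C¹` competitor with the same level-`r` bonds has finite action — a biorthogonality
construction for the bond functionals, not in print and not attempted here).  In `ℝ≥0∞` (plaquette sums `Σ_p ofReal A_∂p²`,
continuum action a `lintegral`) the convergence holds for every mode with no further hypothesis
(`axialTreeAveraging_tendsto_tsum_ofReal_plaqTerm_of_isMode`).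

WHAT THIS MODULE PROVIDES (no definition, no named fact; axioms standard): `axialTreeAveraging_bondApprox_congr_local`,
`axialTreeAveraging_bond_congr_local`, `axialTreeAveraging_plaq_congr_local`, `plaqFunctional_congr_local` (locality);
`exists_contDiff_bounded_localization` (cut-off); **`axialTreeAveraging_tendsto_bondApprox`** ((2.12) for every `C¹` `A`),
**`axialTreeAveraging_plaq_eq_plaqFunctional`** ((1.13)–(1.14) identity for every `C¹` `A`),
`axialTreeAveraging_plaqTerm_eq_plaqTermP_of_contDiff`, **`axialTreeAveraging_tsum_ofReal_plaqTerm_of_contDiff`**,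
**`axialTreeAveraging_latticeActionsConverge_of_contDiff`**, **`axialTreeAveraging_tsum_ofReal_plaqTerm_of_isMode`**,
**`axialTreeAveraging_latticeActionsConverge_of_isMode`** (row F1.Sect§4: `IsMode` + finite action).
-/

namespace Literature.MathematicalPhysics.QuantumFieldTheory.Federbush1986

noncomputable section

open MeasureTheory Filter Set intervalIntegral
open scoped Topology BigOperators ENNReal

/-! ## §1 Locality of the r-approximates, of the bond assignment (2.12) and of the plaquette assignment -/

open AxialTree in
/-- **Locality of the r-approximates**: if `A = A'` on the ball of radius `11ℓ_s` about the base vertex of the level-`s` edge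
`e`, then `A(e, r₀) = A'(e, r₀)` for every `r₀ ≥ s`. [cite: Federbush1986PhaseCellI, (2.13) p. 326; §1 (1.10)–(1.11) p. 323–324] -/
theorem axialTreeAveraging_bondApprox_congr_local {A A' : E4 → Fin 4 → ℝ} {s r₀ : ℕ} (hs : s ≤ r₀) (e : Edge s)
    (h : ∀ y ∈ Metric.ball e.src (11 * latLen s), A y = A' y) :
    axialTreeAveraging.bondApprox r₀ s A e = axialTreeAveraging.bondApprox r₀ s A' e := by
  unfold AbelianAveraging.bondApprox
  rw [axialTreeAveraging_av_of_le hs, axialTreeAveraging_av_of_le hs]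
  obtain ⟨b, μ⟩ := e
  show (avStep^[r₀ - s] (toCfg (approxTop r₀ A))) b μ = (avStep^[r₀ - s] (toCfg (approxTop r₀ A'))) b μ
  refine iterate_avStep_congr_local _ _ (r₀ - s) b μ (fun b' hb' ν => ?_)
  have hin : ∀ i, |b' i - 2 ^ (r₀ - s) * b i| ≤ 3 * 2 ^ (r₀ - s) := fun i => (hb' i).trans (by
    have : (1 : ℤ) ≤ 2 ^ (r₀ - s) := one_le_pow₀ (by norm_num)
    linarith)
  show approxTop r₀ A ⟨b', ν⟩ = approxTop r₀ A' ⟨b', ν⟩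
  unfold approxTop
  congr 1
  refine setIntegral_congr_fun measurableSet_Icc (fun u hu => ?_)
  have hd := dist_sample_lt hs b b' μ ν hin u hu
  simp only
  rw [h _ (Metric.mem_ball.2 hd)]

/-- **Locality of the bond assignment (2.12)**: if `A = A'` on the ball of radius `11ℓ_s` about the base vertex of `e`, then
`A(e) = A'(e)` (the two sequences of r-approximates agree for `r₀ ≥ s`, so their `limUnder` agree — no convergence needed).
[cite: Federbush1986PhaseCellI, (2.12)–(2.13) p. 326] -/
theorem axialTreeAveraging_bond_congr_local {A A' : E4 → Fin 4 → ℝ} {s : ℕ} (e : Edge s)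
    (h : ∀ y ∈ Metric.ball e.src (11 * latLen s), A y = A' y) :
    axialTreeAveraging.bond s A e = axialTreeAveraging.bond s A' e := by
  have hev : (fun r₀ => axialTreeAveraging.bondApprox r₀ s A e) =ᶠ[atTop]
      (fun r₀ => axialTreeAveraging.bondApprox r₀ s A' e) :=
    (eventually_ge_atTop s).mono fun r₀ hr => axialTreeAveraging_bondApprox_congr_local hr e h
  unfold AbelianAveraging.bond limUnder
  rw [Filter.map_congr hev]

/-- The four edges of a plaquette are based within `ℓ_s` of its corner. [cite: Federbush1986PhaseCellI, Fig. 4 p. 324] -/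
theorem Plaq.dist_edge_src_le {s : ℕ} (p : Plaq s) :
    dist (⟨p.base, p.dir₁⟩ : Edge s).src p.src ≤ latLen s ∧
      dist (⟨p.base + Pi.single p.dir₁ 1, p.dir₂⟩ : Edge s).src p.src ≤ latLen s ∧
      dist (⟨p.base + Pi.single p.dir₂ 1, p.dir₁⟩ : Edge s).src p.src ≤ latLen s ∧
      dist (⟨p.base, p.dir₂⟩ : Edge s).src p.src ≤ latLen s := by
  have h0 : ∀ d : Fin 4, (⟨p.base, d⟩ : Edge s).src = p.src := fun d => rfl
  have hℓ : 0 ≤ latLen s := (latLen_pos s).le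
  refine ⟨?_, ?_, ?_, ?_⟩
  · rw [h0, dist_self]; exact hℓ
  · rw [dist_comm, ← h0 p.dir₂, AbelianAveraging.dist_src_shift]
  · rw [dist_comm, ← h0 p.dir₁, AbelianAveraging.dist_src_shift]
  · rw [h0, dist_self]; exact hℓ

/-- **Locality of the plaquette assignment**: if `A = A'` on the ball of radius `13ℓ_s` about the corner of `p`, then
`A_∂p = A'_∂p` for the Bałaban averaging with the axial trees. [cite: Federbush1986PhaseCellI, (2.13) p. 326, Fig. 4 p. 324] -/
theorem axialTreeAveraging_plaq_congr_local {A A' : E4 → Fin 4 → ℝ} {s : ℕ} (p : Plaq s)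
    (h : ∀ y ∈ Metric.ball p.src (13 * latLen s), A y = A' y) :
    axialTreeAveraging.plaq s A p = axialTreeAveraging.plaq s A' p := by
  have hloc : ∀ e : Edge s, dist e.src p.src ≤ latLen s →
      axialTreeAveraging.bond s A e = axialTreeAveraging.bond s A' e := by
    intro e he
    refine axialTreeAveraging_bond_congr_local e fun y hy => h y ?_
    rw [Metric.mem_ball] at hy ⊢
    calc dist y p.src ≤ dist y e.src + dist e.src p.src := dist_triangle _ _ _
      _ < 11 * latLen s + latLen s := add_lt_add_of_lt_of_le hy he
      _ ≤ 13 * latLen s := by linarith [latLen_pos s]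
  obtain ⟨h1, h2, h3, h4⟩ := Plaq.dist_edge_src_le p
  unfold AbelianAveraging.plaq plaqOfBonds
  rw [hloc _ h1, hloc _ h2, hloc _ h3, hloc _ h4]

/-- The sample points of the line integrals in (1.13) lie within `4ℓ` of the corner. [cite: Federbush1986PhaseCellI,
(1.13)–(1.14) p. 324] -/
private theorem dist_linePt_le {ℓ : ℝ} (hℓ : 0 ≤ ℓ) (x : E4) {u : Fin 4 → ℝ} (hu : u ∈ Icc (0 : Fin 4 → ℝ) 1)
    {σ t : ℝ} (hσ : σ ∈ Icc (0 : ℝ) ℓ) (ht : t ∈ Icc (0 : ℝ) ℓ) (i j : Fin 4) :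
    dist (x + ℓ • mkPt u + σ • unitVec i + t • unitVec j) x ≤ 4 * ℓ :=
  AbelianAveraging.dist_samplePt_le hℓ x hu hσ ht i j

/-- **Locality of the continuum plaquette functional (1.13)**: it reads `A` only within `4ℓ_s` of the corner; if `A = A'`
on the ball of radius `13ℓ_s` about `p.src` then `plaqFunctional s A p = plaqFunctional s A' p`.
[cite: Federbush1986PhaseCellI, (1.12)–(1.14) p. 324] -/
theorem plaqFunctional_congr_local {A A' : E4 → Fin 4 → ℝ} {s : ℕ} (p : Plaq s)
    (h : ∀ y ∈ Metric.ball p.src (13 * latLen s), A y = A' y) :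
    plaqFunctional s A p = plaqFunctional s A' p := by
  have hℓ := latLen_pos s
  have hI : Set.uIcc (0 : ℝ) (latLen s) = Icc 0 (latLen s) := Set.uIcc_of_le hℓ.le
  have h0 : (0 : ℝ) ∈ Icc (0 : ℝ) (latLen s) := ⟨le_rfl, hℓ.le⟩
  have hL : latLen s ∈ Icc (0 : ℝ) (latLen s) := ⟨hℓ.le, le_rfl⟩
  -- every sample point is within `4ℓ < 13ℓ`
  have hball : ∀ {u : Fin 4 → ℝ}, u ∈ Icc (0 : Fin 4 → ℝ) 1 → ∀ {σ t : ℝ}, σ ∈ Icc (0 : ℝ) (latLen s) →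
      t ∈ Icc (0 : ℝ) (latLen s) → ∀ i j : Fin 4,
      p.src + latLen s • mkPt u + σ • unitVec i + t • unitVec j ∈ Metric.ball p.src (13 * latLen s) := by
    intro u hu σ t hσ ht i j
    rw [Metric.mem_ball]
    calc _ ≤ 4 * latLen s := dist_linePt_le hℓ.le p.src hu hσ ht i j
      _ < 13 * latLen s := by linarith
  -- the line integrals
  have hline : ∀ {u : Fin 4 → ℝ}, u ∈ Icc (0 : Fin 4 → ℝ) 1 → ∀ {σ : ℝ}, σ ∈ Icc (0 : ℝ) (latLen s) → ∀ i j : Fin 4,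
      lineInt A (p.src + latLen s • mkPt u + σ • unitVec i) j (latLen s)
        = lineInt A' (p.src + latLen s • mkPt u + σ • unitVec i) j (latLen s) := by
    intro u hu σ hσ i j
    unfold lineInt
    refine intervalIntegral.integral_congr fun t ht => ?_
    rw [hI] at ht
    rw [h _ (hball hu hσ ht i j)]
  unfold plaqFunctional
  refine setIntegral_congr_fun measurableSet_Icc fun u hu => ?_
  unfold loopInt
  have e1 := hline hu h0 p.dir₁ p.dir₁
  have e2 := hline hu hL p.dir₁ p.dir₂
  have e3 := hline hu hL p.dir₂ p.dir₁
  have e4 := hline hu h0 p.dir₂ p.dir₂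
  simp only [zero_smul, add_zero] at e1 e4
  rw [e1, e2, e3, e4]

/-! ## §2 Cut-off: a `C¹` potential agrees near any point with a `C¹` potential obeying (2.3)–(2.4) -/

/-- **Smooth cut-off.**  For a `C¹` potential `A`, a centre `c` and a radius `R > 0` there is a `C¹` potential `A'` with
GLOBAL bounds (2.3)–(2.4) that agrees with `A` on the ball `B(c, R)` (`A' = χ·A`, `χ` a smooth bump function).
[cite: Federbush1986PhaseCellI, (2.3)–(2.4) p. 325, (2.13) p. 326] -/
theorem exists_contDiff_bounded_localization {A : E4 → Fin 4 → ℝ} (hA : ContDiff ℝ 1 A) (c : E4) {R : ℝ} (hR : 0 < R) :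
    ∃ (A' : E4 → Fin 4 → ℝ) (B₁ B₂ : ℝ), ContDiff ℝ 1 A' ∧ (∀ x μ, |A' x μ| ≤ B₁) ∧ (∀ x ν μ, |pd A' ν μ x| ≤ B₂) ∧
      ∀ y ∈ Metric.ball c R, A y = A' y := by
  let χ : ContDiffBump c := ⟨R, 2 * R, hR, by linarith⟩
  have hχ : ContDiff ℝ 1 (χ : E4 → ℝ) := χ.contDiff
  have hAμ : ∀ μ, ContDiff ℝ 1 fun y => A y μ := fun μ => contDiff_pi.1 hA μ
  set A' : E4 → Fin 4 → ℝ := fun y μ => χ y * A y μ with hA'def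
  have hg : ∀ μ, ContDiff ℝ 1 fun y => A' y μ := fun μ => hχ.mul (hAμ μ)
  have hA' : ContDiff ℝ 1 A' := contDiff_pi.2 hg
  have hsupp : ∀ μ, HasCompactSupport fun y => A' y μ := fun μ => χ.hasCompactSupport.mul_right
  -- bounds on the components
  have hb₁ : ∀ μ, ∃ C, ∀ x, |A' x μ| ≤ C := by
    intro μ
    obtain ⟨C, hC⟩ := (hg μ).continuous.bounded_above_of_compact_support (hsupp μ)
    exact ⟨C, fun x => by simpa [Real.norm_eq_abs] using hC x⟩
  choose C₁ hC₁ using hb₁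
  -- bounds on the derivatives of the components
  have hb₂ : ∀ μ, ∃ C, ∀ x ν, |pd A' ν μ x| ≤ C := by
    intro μ
    have hcont : Continuous (fderiv ℝ fun y => A' y μ) := (hg μ).continuous_fderiv one_ne_zero
    obtain ⟨C, hC⟩ := hcont.bounded_above_of_compact_support ((hsupp μ).fderiv (𝕜 := ℝ))
    refine ⟨C, fun x ν => ?_⟩
    unfold pd
    calc |fderiv ℝ (fun y => A' y μ) x (unitVec ν)| = ‖fderiv ℝ (fun y => A' y μ) x (unitVec ν)‖ := (Real.norm_eq_abs _).symm
      _ ≤ ‖fderiv ℝ (fun y => A' y μ) x‖ * ‖(unitVec ν : E4)‖ := ContinuousLinearMap.le_opNorm _ _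
      _ ≤ C * 1 := by
          refine mul_le_mul (hC x) ?_ (norm_nonneg _) ((norm_nonneg _).trans (hC x))
          unfold unitVec
          simp
      _ = C := mul_one C
  choose C₂ hC₂ using hb₂
  refine ⟨A', ∑ μ, |C₁ μ|, ∑ μ, |C₂ μ|, hA', fun x μ => ?_, fun x ν μ => ?_, fun y hy => ?_⟩
  · exact ((hC₁ μ x).trans (le_abs_self _)).trans
      (Finset.single_le_sum (fun i _ => abs_nonneg (C₁ i)) (Finset.mem_univ μ))
  · exact ((hC₂ μ x ν).trans (le_abs_self _)).trans
      (Finset.single_le_sum (fun i _ => abs_nonneg (C₂ i)) (Finset.mem_univ μ))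
  · have h1 : χ y = 1 := χ.one_of_mem_closedBall (Metric.ball_subset_closedBall hy)
    funext μ
    simp [A', h1]

/-! ## §3 (2.12) and the plaquette identity (1.13)–(1.14) for EVERY `C¹` potential -/

/-- **(2.12) for every `C¹` potential** (row F1.Eq2.12 without (2.3)–(2.4)): the r-approximates of every edge converge to the
bond assignment. [cite: Federbush1986PhaseCellI, (2.12)–(2.13) p. 326] -/
theorem axialTreeAveraging_tendsto_bondApprox {A : E4 → Fin 4 → ℝ} (hA : ContDiff ℝ 1 A) (s : ℕ) (e : Edge s) :
    Tendsto (fun r₀ => axialTreeAveraging.bondApprox r₀ s A e) atTop (𝓝 (axialTreeAveraging.bond s A e)) := by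
  obtain ⟨A', B₁, B₂, hA', hB₁, hB₂, hAA'⟩ :=
    exists_contDiff_bounded_localization hA e.src (R := 11 * latLen s) (by have := latLen_pos s; positivity)
  have hev : (fun r₀ => axialTreeAveraging.bondApprox r₀ s A' e) =ᶠ[atTop]
      (fun r₀ => axialTreeAveraging.bondApprox r₀ s A e) :=
    (eventually_ge_atTop s).mono fun r₀ hr => (axialTreeAveraging_bondApprox_congr_local hr e hAA').symm
  rw [axialTreeAveraging_bond_congr_local e hAA']
  exact (axialTreeAveraging_eq212 A' B₁ B₂ hA' hB₁ hB₂ s e).congr' hev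

/-- **«This assignment yields the correct plaquette variables» for EVERY `C¹` potential** (row F1.Eq1.13 without
(2.3)–(2.4)): at every level the plaquette values `A_∂p` of the bond assignments (2.12) of the Bałaban averaging with the axial
trees equal the continuum functional (1.13)–(1.14). [cite: Federbush1986PhaseCellI, (1.13)–(1.14) p. 324; §2 p. 325; (2.13)
p. 326] -/
theorem axialTreeAveraging_plaq_eq_plaqFunctional {A : E4 → Fin 4 → ℝ} (hA : ContDiff ℝ 1 A) (s : ℕ) (p : Plaq s) :
    axialTreeAveraging.plaq s A p = plaqFunctional s A p := by
  obtain ⟨A', B₁, B₂, hA', hB₁, hB₂, hAA'⟩ :=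
    exists_contDiff_bounded_localization hA p.src (R := 13 * latLen s) (by have := latLen_pos s; positivity)
  rw [axialTreeAveraging_plaq_congr_local p hAA', plaqFunctional_congr_local p hAA']
  exact axialTreeAveraging_plaquetteAssignmentsEq114 A' B₁ B₂ hA' hB₁ hB₂ s p

/-! ## §4 Row F1.Sect§4 for every `C¹` potential / every mode -/

/-- For every `C¹` potential the Wilson-action summand of the bond assignments IS `plaqTermP` and `S^s_0 = S^s[P]`.
[cite: Federbush1986PhaseCellI, (1.14) p. 324, §2 p. 325, §4 p. 329] -/
theorem axialTreeAveraging_plaqTerm_eq_plaqTermP_of_contDiff {A : E4 → Fin 4 → ℝ} (hA : ContDiff ℝ 1 A) (s : ℕ) :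
    AbelianAveraging.plaqTerm s (axialTreeAveraging.bond s A) = plaqTermP s A ∧
      AbelianAveraging.latticeAction s (axialTreeAveraging.bond s A) = latticeActionP s A := by
  have hp : ∀ p : Plaq s, plaqOfBonds (axialTreeAveraging.bond s A) p = plaqFunctional s A p :=
    fun p => axialTreeAveraging_plaq_eq_plaqFunctional hA s p
  have h1 : AbelianAveraging.plaqTerm s (axialTreeAveraging.bond s A) = plaqTermP s A := by
    funext p
    unfold AbelianAveraging.plaqTerm plaqTermP
    rw [hp]
  refine ⟨h1, ?_⟩
  rw [AbelianAveraging.latticeAction_eq_tsum_plaqTerm, h1]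
  rfl

/-- **For EVERY `C¹` potential**: the `ℝ≥0∞` Wilson actions `Σ_p [μ<ν] ofReal A_∂p²` of the Bałaban bond assignments are
bounded by the continuum action at every level and converge to it — no decay, no boundedness, no finiteness hypothesis.
[cite: Federbush1986PhaseCellI, §4 p. 329] -/
theorem axialTreeAveraging_tsum_ofReal_plaqTerm_of_contDiff {A : E4 → Fin 4 → ℝ} (hA : ContDiff ℝ 1 A) :
    (∀ s, ∑' p : Plaq s, ENNReal.ofReal (AbelianAveraging.plaqTerm s (axialTreeAveraging.bond s A) p) ≤ contAction A) ∧
      Tendsto (fun s => ∑' p : Plaq s, ENNReal.ofReal (AbelianAveraging.plaqTerm s (axialTreeAveraging.bond s A) p))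
        atTop (𝓝 (contAction A)) := by
  have h : ∀ s, AbelianAveraging.plaqTerm s (axialTreeAveraging.bond s A) = plaqTermP s A :=
    fun s => (axialTreeAveraging_plaqTerm_eq_plaqTermP_of_contDiff hA s).1
  simp_rw [h]
  exact ⟨tsum_ofReal_plaqTermP_le hA, tendsto_tsum_ofReal_plaqTermP hA⟩

/-- **Row F1.Sect§4 for every `C¹` potential with finite action**: every level's Wilson action `S^s_0` of the Bałaban bond
assignments is a convergent series and `S^s_0 → contAction A` — the conclusion of `LatticeActionsConvergeSummable`.
[cite: Federbush1986PhaseCellI, §4 p. 329] -/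
theorem axialTreeAveraging_latticeActionsConverge_of_contDiff {A : E4 → Fin 4 → ℝ} (hA : ContDiff ℝ 1 A)
    (hfin : contAction A ≠ ⊤) :
    (∀ s, Summable (AbelianAveraging.plaqTerm s (axialTreeAveraging.bond s A))) ∧
      Tendsto (fun s => ENNReal.ofReal (AbelianAveraging.latticeAction s (axialTreeAveraging.bond s A))) atTop
        (𝓝 (contAction A)) := by
  refine ⟨fun s => ?_, ?_⟩
  · rw [(axialTreeAveraging_plaqTerm_eq_plaqTermP_of_contDiff hA s).1]
    exact summable_plaqTermP_of_finiteAction hA hfin s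
  · have : (fun s => ENNReal.ofReal (AbelianAveraging.latticeAction s (axialTreeAveraging.bond s A)))
        = fun s => ENNReal.ofReal (latticeActionP s A) :=
      funext fun s => by rw [(axialTreeAveraging_plaqTerm_eq_plaqTermP_of_contDiff hA s).2]
    rw [this]
    exact tendsto_latticeActionP_of_finiteAction hA hfin

/-- **For every MODE** (antecedent `IsMode` alone): the `ℝ≥0∞` Wilson actions of its bond assignments are bounded by and
converge to its continuum action. [cite: Federbush1986PhaseCellI, §3 (3.1) p. 326–327, §4 p. 329] -/
theorem axialTreeAveraging_tsum_ofReal_plaqTerm_of_isMode {A : E4 → Fin 4 → ℝ} {c₀ : ℝ} {r : ℕ}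
    (hm : axialTreeAveraging.IsMode c₀ r A) :
    (∀ s, ∑' p : Plaq s, ENNReal.ofReal (AbelianAveraging.plaqTerm s (axialTreeAveraging.bond s A) p) ≤ contAction A) ∧
      Tendsto (fun s => ∑' p : Plaq s, ENNReal.ofReal (AbelianAveraging.plaqTerm s (axialTreeAveraging.bond s A) p))
        atTop (𝓝 (contAction A)) := by
  obtain ⟨_, _, hmin⟩ := hm
  exact axialTreeAveraging_tsum_ofReal_plaqTerm_of_contDiff hmin.1

/-- **Row F1.Sect§4 for every MODE with finite action** — the conclusion of `axialTreeAveraging.LatticeActionsConvergeSummable`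
with the single remaining binder `contAction A ≠ ⊤`. [cite: Federbush1986PhaseCellI, §3 (3.1) p. 326–327, §4 p. 329] -/
theorem axialTreeAveraging_latticeActionsConverge_of_isMode {A : E4 → Fin 4 → ℝ} {c₀ : ℝ} {r : ℕ}
    (hm : axialTreeAveraging.IsMode c₀ r A) (hfin : contAction A ≠ ⊤) :
    (∀ s, Summable (AbelianAveraging.plaqTerm s (axialTreeAveraging.bond s A))) ∧
      Tendsto (fun s => ENNReal.ofReal (AbelianAveraging.latticeAction s (axialTreeAveraging.bond s A))) atTop
        (𝓝 (contAction A)) := by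
  obtain ⟨_, _, hmin⟩ := hm
  exact axialTreeAveraging_latticeActionsConverge_of_contDiff hmin.1 hfin

end

end Literature.MathematicalPhysics.QuantumFieldTheory.Federbush1986
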